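import Literature.Geometry.Kaehler.ComplexTorusLefschetzSL2ActionCharacter
import Literature.Algebra.Lie.LefschetzModuleCharacterStrings
import HarnessLib

/-!
# The character of Beauville's `SL₂`-action on `H•(X; ℂ)` as a sum of irreducible characters:
# `tr ρ(diag(t, t⁻¹)) = Σ_{n=0}^{g} dim P^{g−n}(η) · (t^{−n} + t^{−n+2} + ⋯ + tⁿ)` — `V_n` occurs `dim P^{g−n}(η)` times —
# hence `Σ_{k=0}^{2g} C(2g, k) t^{k−g} = Σ_{n=0}^{g} dim P^{g−n}(η) Σ_{l=0}^{n} t^{2l−n}` and `Σ_{n=0}^{g} (−1)ⁿ (n+1) dim P^{g−n}(η) = 0`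

Layer `Literature/Geometry/Kaehler`, namespace `Literature.Geometry.Kaehler.ComplexTorus`; lane `lit-hodgefound` (Track 2 foundations
library), prover seat `lit-hodgefound-p09` (generation 53, row g53-#4). THEOREMS ONLY (no definition, no named fact, no instance, no
notation; D-0026 net debt `0`). Sequel of rows g53-#2 `ComplexTorusLefschetzSL2ActionCharacter` (`trace_sl2Rep_diagonal`:
`tr ρ(diag(t, t⁻¹)) = Σ_{k≤2g} C(2g, k) t^{k−g}`, `trace_sl2Rep_neg_one_eq_zero`, `finrank_primitiveSpace_countingG`: the abstract `P_{−n}` has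
the dimension of Lange's `P^{g−n}(η)`, `finrank_primitiveSpace_countingG_of_lt`) and g53-#3 `Algebra/Lie/LefschetzModuleCharacterStrings`
(ABSTRACT: `HasLefschetzProperty.trace_torus_eq_sum_strings` `tr tʰ = Σ_{a<D} dim P_{−a} · Σ_{l≤a} t^{2l−a}`, `trace_sl2Rep_neg_one_eq_sum`).

SETTING. `E` a complex normed space of dimension `g ≥ 1` (`V = H₁(X; ℝ)`), `H•(X; ℂ) = GForm E ℂ` graded by `h = countingG E`, `η` a
non-degenerate real `2`-form, `ρ = (hasLefschetzProperty_lefschetzG hη).sl2Rep isZGrading_countingG`, `Pᵏ(η) = primitiveForms η k`; the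
irreducible `V_n = Symⁿ(ℂ²)` has character `χ_n(t) = Σ_{l=0}^{n} t^{2l−n}` (written out, no definition).

## What is proved

* **`trace_sl2Rep_diagonal_eq_sum_primitiveForms`: `tr ρ(diag(t, t⁻¹)) = Σ_{n=0}^{g} dim P^{g−n}(η) · Σ_{l=0}^{n} t^{2l−n}`** — on the
  cohomology of a polarised complex torus the irreducible `V_n` (the string `α, L_η α, …, L_ηⁿ α` of a primitive `α ∈ P^{g−n}(η)`) occurs
  with multiplicity `dim P^{g−n}(η)` (`= C(2g, g−n) − C(2g, g−n−2)`): Beauville's "`CH(A)` is a direct sum of subrepresentations of this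
  type" as a character identity; `trace_torus_countingG_eq_sum_primitiveForms` (any `t`, the torus `tʰ` itself).
* **`sum_choose_mul_zpow_eq_sum_primitiveForms`: `Σ_{k=0}^{2g} C(2g, k) t^{k−g} = Σ_{n=0}^{g} dim P^{g−n}(η) · Σ_{l=0}^{n} t^{2l−n}`** for every
  `t ∈ ℂ` — the two forms of the character (row g53-#2 and this row) compared: the Poincaré polynomial of `X` resolved into strings.
* **`sum_neg_one_pow_mul_succ_mul_finrank_primitiveForms_eq_zero`: `Σ_{n=0}^{g} (−1)ⁿ (n + 1) dim P^{g−n}(η) = 0`** (in `ℤ`) — the character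
  at `−1` vanishes (`tr ρ(−1) = 0`, `g ≥ 1`) while `χ_n(−1) = (−1)ⁿ(n+1)`.

## Sources, VERBATIM

* A. Beauville, *The action of SL₂ on abelian varieties*, J. Ramanujan Math. Soc. 25 (2010) [Beauville2010SL2] (held text `paper:arxiv-0805.1541`
  p0006), §5: "**Proposition** If `z ∈ CH^p_s(A)` is primitive, […] `(z, θz, …, θ^{g+s−2p} z)` is a basis of an irreducible subrepresentation
  of `CH(A)`. The vector space `CH(A)` is a direct sum of subrepresentations of this type. **Corollary** […] `CH^p_s(A) = ⊕_{q ≤ p} θ^{p−q} P^q_s`";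
  §3 Theorem, proof (p0004): "`τ(t) = t^{−g} Σᵢ tⁱ πᵢ`".
* W. Fulton, J. Harris, *Representation Theory. A First Course*, GTM 129 [FultonHarris1991], §11.1 (11.7) ("the eigenvalues of `H` on `V` are
  precisely `n, n − 2, …, −n + 2, −n`"), §23.2 (23.23), (23.40).
* H. Lange, *Abelian Varieties over the Complex Numbers* (2023) [Lange2023AbelianVarietiesComplex], §7.3.2 (1), (3) (p. 338) and §1.1.3 Cor. 1.1.19.

## Scope

Torus-forms carrier; the total-dimension count at `t = 1` (`4^g = Σ_a (g − a + 1) dim Pᵃ(η)`) is the tree's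
`finrank_gForm_eq_sum_mul_finrank_primitiveForms` and is not restated.
-/

noncomputable section

-- `Module ℂ` / `SMulZeroClass ℂ` synthesis on `E [⋀^Fin k]→L[ℝ] ℂ` (as in `ComplexTorusLefschetzDecomposition`)
set_option maxSynthPendingDepth 3

namespace Literature.Geometry.Kaehler

namespace ComplexTorus

open Module Function Finset
open scoped MatrixGroups
open Literature.LinearAlgebra.Alternating Literature.Algebra.Lie

universe uE

variable {E : Type uE} [NormedAddCommGroup E] [NormedSpace ℂ E] [FiniteDimensional ℂ E] [Nontrivial E] {η : E [⋀^Fin 2]→L[ℝ] ℝ}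

omit [Nontrivial E] in
/-- `g + 1 ≤ dim_ℂ H•(X; ℂ) = 4^g`. [cite: Lange2023AbelianVarietiesComplex, §1.1 Exercise (8)] -/
private theorem finrank_succ_le_finrank_gForm₇₄ : finrank ℂ E + 1 ≤ finrank ℂ (GForm E ℂ) := by
  rw [finrank_gForm]
  exact (Nat.succ_le_of_lt Nat.lt_two_pow_self).trans (Nat.pow_le_pow_right (by norm_num) (by omega))

/-- **`tr tʰ = Σ_{n=0}^{g} dim P^{g−n}(η) · Σ_{l=0}^{n} t^{2l−n}`** on `H•(X; ℂ)` for every `t` and every non-degenerate `η`: the abstract string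
character (`trace_torus_eq_sum_strings`) with `dim P_{−n} = dim P^{g−n}(η)` for `n ≤ g` and `P_{−n} = 0` for `n > g`.
[cite: Beauville2010SL2, §5 Proposition and Corollary (p. 6)] [cite: FultonHarris1991, §23.2 (23.23), (23.40)] -/
theorem trace_torus_countingG_eq_sum_primitiveForms (hη : ∀ v : E, v ≠ 0 → ∃ w : E, η ![v, w] ≠ 0) (t : ℂ) :
    LinearMap.trace ℂ (GForm E ℂ) ((isZGrading_countingG (E := E)).torus t) =
      ∑ n ∈ range (finrank ℂ E + 1), (finrank ℂ ↥(primitiveForms η (finrank ℂ E - n)) : ℂ) * ∑ l ∈ range (n + 1), t ^ (2 * (l : ℤ) - n) := by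
  rw [(hasLefschetzProperty_lefschetzG hη).trace_torus_eq_sum_strings' isZGrading_countingG t,
    ← sum_subset (range_mono finrank_succ_le_finrank_gForm₇₄) fun n _ hn ↦ by
      rw [mem_range, not_lt] at hn
      rw [finrank_primitiveSpace_countingG_of_lt (η := η) (by omega), Nat.cast_zero, zero_mul]]
  exact sum_congr rfl fun n hn ↦ by rw [finrank_primitiveSpace_countingG hη (by rw [mem_range] at hn; omega)]

/-- **`tr ρ(diag(t, t⁻¹)) = Σ_{n=0}^{g} dim P^{g−n}(η) · Σ_{l=0}^{n} t^{2l−n}`**: the character of Beauville's `SL₂(ℂ)` on the cohomology of a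
polarised complex torus as a sum of irreducible characters — `V_n` (the string `α, L_η α, …, L_ηⁿ α`, `α ∈ P^{g−n}(η)` primitive) occurs with
multiplicity `dim P^{g−n}(η)` ("`CH(A)` is a direct sum of subrepresentations of this type").
[cite: Beauville2010SL2, §4 Theorem and §5 Proposition, Corollary (p. 6)] [cite: FultonHarris1991, §11.1 (11.7), §23.2 (23.40)] -/
theorem trace_sl2Rep_diagonal_eq_sum_primitiveForms (hη : ∀ v : E, v ≠ 0 → ∃ w : E, η ![v, w] ≠ 0) (γ : SL(2, ℂ)) {t : ℂ}
    (hγ : (γ : Matrix (Fin 2) (Fin 2) ℂ) = !![t, 0; 0, t⁻¹]) :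
    LinearMap.trace ℂ (GForm E ℂ) ((hasLefschetzProperty_lefschetzG hη).sl2Rep isZGrading_countingG γ) =
      ∑ n ∈ range (finrank ℂ E + 1), (finrank ℂ ↥(primitiveForms η (finrank ℂ E - n)) : ℂ) * ∑ l ∈ range (n + 1), t ^ (2 * (l : ℤ) - n) := by
  rw [(hasLefschetzProperty_lefschetzG hη).sl2Rep_apply_of_coe_eq_diagonal isZGrading_countingG γ hγ,
    trace_torus_countingG_eq_sum_primitiveForms hη]

/-- **`Σ_{k=0}^{2g} C(2g, k) t^{k−g} = Σ_{n=0}^{g} dim P^{g−n}(η) · Σ_{l=0}^{n} t^{2l−n}`** for every `t ∈ ℂ` and every non-degenerate `η`: the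
Poincaré polynomial `t^{−g}(1 + t)^{2g}` of `X` resolved into the characters of the strings (both sides are `tr tʰ`, rows g53-#2 ∕ #3).
[cite: Beauville2010SL2, §3 Theorem (proof, "τ(t) = t^{−g} Σᵢ tⁱ πᵢ") and §5 Corollary] [cite: Lange2023AbelianVarietiesComplex, §7.3.2 (1), (3) (p. 338)] -/
theorem sum_choose_mul_zpow_eq_sum_primitiveForms (hη : ∀ v : E, v ≠ 0 → ∃ w : E, η ![v, w] ≠ 0) (t : ℂ) :
    ∑ k ∈ range (2 * finrank ℂ E + 1), ((2 * finrank ℂ E).choose k : ℂ) * t ^ ((k : ℤ) - (finrank ℂ E : ℤ)) =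
      ∑ n ∈ range (finrank ℂ E + 1), (finrank ℂ ↥(primitiveForms η (finrank ℂ E - n)) : ℂ) * ∑ l ∈ range (n + 1), t ^ (2 * (l : ℤ) - n) := by
  rw [← trace_torus_countingG t, trace_torus_countingG_eq_sum_primitiveForms hη t]

/-- **`Σ_{n=0}^{g} (−1)ⁿ (n + 1) · dim P^{g−n}(η) = 0`** (`g ≥ 1`): the character at `−1` vanishes (`tr ρ(−1) = 0`, row g53-#2) while `V_n`
contributes `χ_n(−1) = (−1)ⁿ (n + 1)` (row g53-#3). [cite: Beauville2010SL2, §3 Proposition (ii) ("h² = β(−I)") and §5 Proposition]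
[cite: Lange2023AbelianVarietiesComplex, §7.3.2 (3) (p. 338)] -/
theorem sum_neg_one_pow_mul_succ_mul_finrank_primitiveForms_eq_zero (hη : ∀ v : E, v ≠ 0 → ∃ w : E, η ![v, w] ≠ 0) :
    ∑ n ∈ range (finrank ℂ E + 1), (-1 : ℤ) ^ n * ((n : ℤ) + 1) * (finrank ℂ ↥(primitiveForms η (finrank ℂ E - n)) : ℤ) = 0 := by
  have h := (hasLefschetzProperty_lefschetzG hη).trace_sl2Rep_neg_one_eq_sum isZGrading_countingG
  rw [trace_sl2Rep_neg_one_eq_zero hη, ← sum_subset (range_mono finrank_succ_le_finrank_gForm₇₄) fun n _ hn ↦ by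
      rw [mem_range, not_lt] at hn
      rw [finrank_primitiveSpace_countingG_of_lt (η := η) (by omega), Nat.cast_zero, mul_zero],
    sum_congr rfl fun n hn ↦ by rw [finrank_primitiveSpace_countingG hη (by rw [mem_range] at hn; omega)]] at h
  exact_mod_cast h.symm

end ComplexTorus

end Literature.Geometry.Kaehler

end
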